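import Summits.KontsevichZagierPeriods.KontsevichZagierPeriods.Theorems.KzOnePeriodsG0Derivation

/-!
# KontsevichZagierPeriods — kz1p (R1)–(R5) derivations, part 6: poles of higher order

Cell pub-kz1p, seat b2b-kz1p-2, gen 12 (kz1p v1.3; PROCEDURE.md §4d; LEAN-IN-TREE rule).
[cite: HuberWustholz2022, §13.1 (p. 120)]; no named facts, no `sorry`.

The input forms of parts 2–5 carry simple poles and a polynomial part.  A rational `1`-form on
`ℙ¹` with a pole of order `k + 2 ≥ 2` at `a_c` has the additional term `ρ (x − a_c)^{−(k+2)} dx`,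
represented on `Z_a = {y ∏ᵢ (x − aᵢ) = 1}` by the polynomial form `ρ u_c^{k+2} dx` with
`u_c = y ∏_{j ≠ c} (x − a_j)` (`= 1/(x − a_c)` on `Z_a`).  It is exact up to a form vanishing on
`Z_a`: `ρ u_c^{k+2} dx − d(ρ/(−k−1) · u_c^{k+1})` vanishes on the tangent spaces of `Z_a`
(`vanishesOn_hiTerm_sub_formD`), so by (R1)–(R3) its symbol along any path `γ` is
`(Q(γ(1)) − Q(γ(0))) · 𝟙` with `Q = ρ/(−k−1) · (x − a_c)^{−(k+1)}` (`span_hiTerm`,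
`eval_hiPrim_of_mem`).  `red_segment₂` / `red_loop₂` extend the generator interface of part 5 to
input forms `inputForm₂ = inputForm + Σ_h ρ_h u_{c_h}^{k_h+2} dx`.
-/

noncomputable section

open scoped BigOperators Real
open MvPolynomial Set Complex
open Literature.NumberTheory.Transcendental
open Literature.NumberTheory.Transcendental.CurvePeriods

namespace Summit.KontsevichZagierPeriods.KzOnePeriods.G0Derivation

local notation3 "InSpanRel " c:arg => ∃ (k : ℕ) (ρ : Fin k → (PeriodSymbol →₀ ℂ))
  (a : Fin k → ℂ), (∀ l, IsElementaryRelation (ρ l)) ∧ (∀ l, IsAlgebraic ℚ (a l)) ∧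
    c = ∑ l, a l • ρ l
local notation3 (prettyPrint := false) "𝔾m" => (⟨2, 1, ![X 0 * X 1 - 1]⟩ : CurveData)
local notation3 "logSym " E:arg => (⟨⟨2, 1, ![X 0 * X 1 - 1]⟩, isSmoothAffineCurve_mulGroup,
  ![X 1, 0], hasAlgCoeffs_ydx, E⟩ : PeriodSymbol)

section HigherPoles

variable {r : ℕ}

local notation3 (prettyPrint := false) "ZP " a:arg =>
  (⟨2, 1, ![X 1 * ∏ i, (X 0 - C (a i)) - 1]⟩ : CurveData)

/-! ### The polynomial representative `u_c = y ∏_{j≠c}(x − a_j)` of `1/(x − a_c)` on `Z_a` -/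

/-- `P_c = ∏_{j ≠ c} (x − a_j)`. [folklore] -/
def coPol (a : Fin r → ℂ) (c : Fin r) : MvPolynomial (Fin 2) ℂ :=
  ∏ j ∈ Finset.univ.erase c, (X 0 - C (a j))

/-- `u_c = y · P_c` (`= 1/(x − a_c)` on `Z_a`). [folklore] -/
def uPol (a : Fin r → ℂ) (c : Fin r) : MvPolynomial (Fin 2) ℂ := X 1 * coPol a c

/-- `P_c` is over `ℚ̄`. [folklore] -/
theorem hasAlgCoeffs_coPol {a : Fin r → ℂ} (ha : ∀ i, IsAlgebraic ℚ (a i)) (c : Fin r) :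
    HasAlgCoeffs (coPol a c) :=
  hasAlgCoeffs_finsetProd _ _ fun i _ => (hasAlgCoeffs_X 0).sub (hasAlgCoeffs_C (ha i))

/-- `u_c` is over `ℚ̄`. [folklore] -/
theorem hasAlgCoeffs_uPol {a : Fin r → ℂ} (ha : ∀ i, IsAlgebraic ℚ (a i)) (c : Fin r) :
    HasAlgCoeffs (uPol a c) :=
  (hasAlgCoeffs_X 1).mul (hasAlgCoeffs_coPol ha c)

/-- `∂_y P_c = 0`. [folklore] -/
theorem pderiv_one_coPol (a : Fin r → ℂ) (c : Fin r) : pderiv 1 (coPol a c) = 0 :=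
  pderiv_one_prod_X_sub_C a _

/-- `∏ᵢ (x − aᵢ) = (x − a_c) · P_c`. [folklore] -/
theorem prod_eq_mul_coPol (a : Fin r → ℂ) (c : Fin r) :
    (∏ i, (X 0 - C (a i)) : MvPolynomial (Fin 2) ℂ) = (X 0 - C (a c)) * coPol a c :=
  (Finset.mul_prod_erase Finset.univ (fun i => (X 0 - C (a i) : MvPolynomial (Fin 2) ℂ))
    (Finset.mem_univ c)).symm

/-- `P_c(z) = ∏_{j≠c} (z₀ − a_j)`. [folklore] -/
theorem eval_coPol (a : Fin r → ℂ) (c : Fin r) (z : Fin 2 → ℂ) :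
    eval z (coPol a c) = ∏ j ∈ Finset.univ.erase c, (z 0 - a j) := by
  rw [coPol, map_prod]
  exact Finset.prod_congr rfl fun i _ => by simp

/-- `∏ᵢ (z₀ − aᵢ) = (z₀ − a_c) · P_c(z)`. [folklore] -/
theorem prod_eval_eq_mul_coPol (a : Fin r → ℂ) (c : Fin r) (z : Fin 2 → ℂ) :
    ∏ i, (z 0 - a i) = (z 0 - a c) * eval z (coPol a c) := by
  rw [eval_coPol]
  exact (Finset.mul_prod_erase Finset.univ (fun i => z 0 - a i) (Finset.mem_univ c)).symm

/-! ### The higher polar term and its primitive -/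

/-- The higher polar term `ρ u_c^{k+2} dx` (a pole of order `k + 2` at `a_c`). [folklore] -/
def hiTerm (a : Fin r → ℂ) (c : Fin r) (k : ℕ) (ρ : ℂ) : Fin 2 → MvPolynomial (Fin 2) ℂ :=
  ![C ρ * uPol a c ^ (k + 2), 0]

/-- Its primitive `Q = ρ/(−k−1) · u_c^{k+1}`. [folklore] -/
def hiPrim (a : Fin r → ℂ) (c : Fin r) (k : ℕ) (ρ : ℂ) : MvPolynomial (Fin 2) ℂ :=
  C (ρ / (-(k : ℂ) - 1)) * uPol a c ^ (k + 1)

/-- The value of the primitive as a function of `x`: `ρ/(−k−1) · (x − a_c)^{−(k+1)}`. [folklore] -/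
def hiPrimVal (a : Fin r → ℂ) (c : Fin r) (k : ℕ) (ρ : ℂ) (x : ℂ) : ℂ :=
  ρ / (-(k : ℂ) - 1) * (1 / (x - a c)) ^ (k + 1)

/-- `−k − 1 ≠ 0`. [folklore] -/
theorem neg_nat_sub_one_ne_zero (k : ℕ) : (-(k : ℂ) - 1) ≠ 0 := by
  rw [show (-(k : ℂ) - 1) = -((k : ℂ) + 1) by ring]
  exact neg_ne_zero.mpr (Nat.cast_add_one_ne_zero k)

/-- The higher polar term is over `ℚ̄`. [folklore] -/
theorem hasAlgCoeffs_hiTerm {a : Fin r → ℂ} (ha : ∀ i, IsAlgebraic ℚ (a i)) (c : Fin r) (k : ℕ)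
    {ρ : ℂ} (hρ : IsAlgebraic ℚ ρ) : ∀ i, HasAlgCoeffs (hiTerm a c k ρ i) := by
  intro i
  fin_cases i
  · simpa [hiTerm] using (hasAlgCoeffs_C hρ).mul ((hasAlgCoeffs_uPol ha c).pow (k + 2))
  · simpa [hiTerm] using hasAlgCoeffs_zero

/-- The primitive is over `ℚ̄`. [folklore] -/
theorem hasAlgCoeffs_hiPrim {a : Fin r → ℂ} (ha : ∀ i, IsAlgebraic ℚ (a i)) (c : Fin r) (k : ℕ)
    {ρ : ℂ} (hρ : IsAlgebraic ℚ ρ) : HasAlgCoeffs (hiPrim a c k ρ) := by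
  refine (hasAlgCoeffs_C ?_).mul ((hasAlgCoeffs_uPol ha c).pow (k + 1))
  rw [div_eq_mul_inv]
  exact hρ.mul (((isAlgebraic_nat (R := ℚ) (A := ℂ) k).neg.sub isAlgebraic_one).inv)

/-- **`ρ u_c^{k+2} dx − dQ` vanishes on `Z_a`** (`du_c = −u_c² dx` on `Z_a`, so
`d(u_c^{k+1}) = −(k+1) u_c^{k+2} dx`). [folklore] -/
theorem vanishesOn_hiTerm_sub_formD (a : Fin r → ℂ) (c : Fin r) (k : ℕ) (ρ : ℂ) :
    VanishesOn (ZP a) (hiTerm a c k ρ - formD (hiPrim a c k ρ)) := by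
  intro z hz v hv
  rw [mem_points_puncturedLine_iff] at hz
  rw [mem_tangentSpace_puncturedLine_iff, prod_eq_mul_coPol a c, prod_eval_eq_mul_coPol a c] at hv
  rw [prod_eval_eq_mul_coPol a c] at hz
  have hκ : ρ / (-(k : ℂ) - 1) * ((k : ℂ) + 1) = -ρ := by
    field_simp [neg_nat_sub_one_ne_zero k]
    ring
  simp only [Derivation.leibniz, pderiv_X_self, pderiv_C, map_add, map_mul,
    eval_X, eval_C, smul_eq_mul, mul_one, sub_zero, map_sub] at hv
  simp only [Fin.sum_univ_two, Pi.sub_apply, hiTerm, hiPrim, formD, uPol,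
    Matrix.cons_val_zero, Matrix.cons_val_one, Derivation.leibniz,
    Derivation.leibniz_pow, pderiv_X_self, pderiv_X_of_ne (show (1 : Fin 2) ≠ 0 by decide),
    pderiv_C, pderiv_one_coPol, smul_eq_mul,
    nsmul_eq_mul, map_add, map_mul, map_zero, map_one, map_pow, map_sub, map_natCast, eval_X,
    eval_C, mul_one, mul_zero, add_zero, zero_add, Nat.add_succ_sub_one,
    Nat.cast_add, Nat.cast_one]
  linear_combination (ρ * (z 1 * eval z (coPol a c)) ^ k * z 1 * eval z (coPol a c)) * hv -
    (ρ * (z 1 * eval z (coPol a c)) ^ k *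
      (z 1 * eval z (pderiv 0 (coPol a c)) * v 0 + eval z (coPol a c) * v 1)) * hz -
    ((z 1 * eval z (coPol a c)) ^ k *
      (z 1 * eval z (pderiv 0 (coPol a c)) * v 0 + eval z (coPol a c) * v 1)) * hκ

/-- On `Z_a`, `Q(z) = ρ/(−k−1) · (z₀ − a_c)^{−(k+1)}`. [folklore] -/
theorem eval_hiPrim_of_mem (a : Fin r → ℂ) (c : Fin r) (k : ℕ) (ρ : ℂ) {z : Fin 2 → ℂ}
    (hz : z ∈ (ZP a).points) : eval z (hiPrim a c k ρ) = hiPrimVal a c k ρ (z 0) := by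
  rw [mem_points_puncturedLine_iff, prod_eval_eq_mul_coPol a c] at hz
  have hne : z 0 - a c ≠ 0 := by
    intro h
    rw [h] at hz
    simp at hz
  have hu : z 1 * eval z (coPol a c) = 1 / (z 0 - a c) := by
    field_simp
    linear_combination hz
  simp only [hiPrim, hiPrimVal, uPol, map_mul, map_pow, eval_C, eval_X, hu]

/-- **The symbol of a higher polar term is exact**: `(Z_a, ρ u_c^{k+2} dx, γ) ∼ (Q(γ(1)) − Q(γ(0))) 𝟙`
by (R1) (split off `dQ`), (R2) (`vanishesOn_hiTerm_sub_formD`) and (R3).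
[cite: HuberWustholz2022, §13.1 (A)–(B) (p. 120)] -/
theorem span_hiTerm {a : Fin r → ℂ} (ha : ∀ i, IsAlgebraic ℚ (a i)) (c : Fin r) (k : ℕ) {ρ : ℂ}
    (hρ : IsAlgebraic ℚ ρ) (γ : CurvePath (ZP a)) :
    InSpanRel (Finsupp.single (⟨ZP a, isSmoothAffineCurve_puncturedLine ha, hiTerm a c k ρ,
        hasAlgCoeffs_hiTerm ha c k hρ, γ⟩ : PeriodSymbol) (1 : ℂ) -
      (hiPrimVal a c k ρ (γ.toFun 1 0) - hiPrimVal a c k ρ (γ.toFun 0 0)) •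
        Finsupp.single PeriodSymbol.unit (1 : ℂ)) := by
  have hZ := isSmoothAffineCurve_puncturedLine ha
  have hQ := hasAlgCoeffs_hiPrim ha c k hρ
  have hω := hasAlgCoeffs_hiTerm ha c k hρ
  have hdQ : ∀ i, HasAlgCoeffs (formD (hiPrim a c k ρ) i) := fun i => hQ.pderiv i
  have h₂ : ∀ i, HasAlgCoeffs ((hiTerm a c k ρ - formD (hiPrim a c k ρ)) i) := fun i =>
    (hω i).sub (hdQ i)
  have r₁ := IsElementaryRelation.add (ZP a) hZ γ (hiTerm a c k ρ) (formD (hiPrim a c k ρ))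
    (hiTerm a c k ρ - formD (hiPrim a c k ρ)) hω hdQ h₂ (add_sub_cancel _ _).symm
  have r₂ := IsElementaryRelation.vanish (ZP a) hZ γ _ h₂ (vanishesOn_hiTerm_sub_formD a c k ρ)
  have r₃ := IsElementaryRelation.exact (ZP a) hZ γ (hiPrim a c k ρ) hQ (formD (hiPrim a c k ρ))
    hdQ rfl
  rw [eval_hiPrim_of_mem a c k ρ (γ.mem_points 1 (by norm_num)),
    eval_hiPrim_of_mem a c k ρ (γ.mem_points 0 (by norm_num))] at r₃
  obtain ⟨n, R, b, hR, hb, hsum⟩ :=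
    span_add (span_add (span_of_rel r₁) (span_of_rel r₂)) (span_of_rel r₃)
  refine ⟨n, R, b, hR, hb, ?_⟩
  rw [← hsum]
  abel

/-! ### Input forms with poles of higher order -/

/-- The higher polar part `Σ_h ρ_h u_{c_h}^{k_h+2} dx`. [folklore] -/
def hiForm (a : Fin r → ℂ) {n : ℕ} (hc : Fin n → Fin r) (hk : Fin n → ℕ) (hr : Fin n → ℂ) :
    Fin 2 → MvPolynomial (Fin 2) ℂ :=
  ∑ h, hiTerm a (hc h) (hk h) (hr h)

/-- Its primitive as a function of `x`: `Σ_h ρ_h/(−k_h−1) · (x − a_{c_h})^{−(k_h+1)}`. [folklore] -/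
def hiFormVal (a : Fin r → ℂ) {n : ℕ} (hc : Fin n → Fin r) (hk : Fin n → ℕ) (hr : Fin n → ℂ)
    (x : ℂ) : ℂ :=
  ∑ h, hiPrimVal a (hc h) (hk h) (hr h) x

/-- **Input form with higher-order poles**:
`ω = Σ_c rc_c dx/(x − a_c) + Σ_k pc_k x^k dx + Σ_h hr_h (x − a_{hc_h})^{−(hk_h+2)} dx` on `Z_a`. [folklore] -/
def inputForm₂ (a rc : Fin r → ℂ) {d : ℕ} (pc : Fin d → ℂ) {n : ℕ} (hc : Fin n → Fin r)
    (hk : Fin n → ℕ) (hr : Fin n → ℂ) : Fin 2 → MvPolynomial (Fin 2) ℂ :=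
  inputForm a rc pc + hiForm a hc hk hr

/-- The higher polar part is over `ℚ̄`. [folklore] -/
theorem hasAlgCoeffs_hiForm {a : Fin r → ℂ} (ha : ∀ i, IsAlgebraic ℚ (a i)) {n : ℕ}
    (hc : Fin n → Fin r) (hk : Fin n → ℕ) {hr : Fin n → ℂ} (hhr : ∀ h, IsAlgebraic ℚ (hr h)) :
    ∀ i, HasAlgCoeffs (hiForm a hc hk hr i) := fun i =>
  hasAlgCoeffs_sum_apply _ _ (fun h j => hasAlgCoeffs_hiTerm ha (hc h) (hk h) (hhr h) j) i

/-- The input form with higher-order poles is over `ℚ̄`. [folklore] -/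
theorem hasAlgCoeffs_inputForm₂ {a : Fin r → ℂ} (ha : ∀ i, IsAlgebraic ℚ (a i)) {rc : Fin r → ℂ}
    (hrc : ∀ i, IsAlgebraic ℚ (rc i)) {d : ℕ} {pc : Fin d → ℂ} (hpc : ∀ k, IsAlgebraic ℚ (pc k))
    {n : ℕ} (hc : Fin n → Fin r) (hk : Fin n → ℕ) {hr : Fin n → ℂ}
    (hhr : ∀ h, IsAlgebraic ℚ (hr h)) : ∀ i, HasAlgCoeffs (inputForm₂ a rc pc hc hk hr i) :=
  fun i => (hasAlgCoeffs_inputForm ha hrc hpc i).add (hasAlgCoeffs_hiForm ha hc hk hhr i)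

/-- **The symbol of the higher polar part is exact**:
`(Z_a, Σ_h ρ_h u^{k_h+2} dx, γ) ∼ (H(γ(1)₀) − H(γ(0)₀)) 𝟙`. [folklore] -/
theorem span_hiForm {a : Fin r → ℂ} (ha : ∀ i, IsAlgebraic ℚ (a i)) {n : ℕ} (hc : Fin n → Fin r)
    (hk : Fin n → ℕ) {hr : Fin n → ℂ} (hhr : ∀ h, IsAlgebraic ℚ (hr h)) (γ : CurvePath (ZP a)) :
    InSpanRel (Finsupp.single (⟨ZP a, isSmoothAffineCurve_puncturedLine ha, hiForm a hc hk hr,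
        hasAlgCoeffs_hiForm ha hc hk hhr, γ⟩ : PeriodSymbol) (1 : ℂ) -
      (hiFormVal a hc hk hr (γ.toFun 1 0) - hiFormVal a hc hk hr (γ.toFun 0 0)) •
        Finsupp.single PeriodSymbol.unit (1 : ℂ)) := by
  have hZ := isSmoothAffineCurve_puncturedLine ha
  have h₁ := span_single_finsetSum (ZP a) hZ γ Finset.univ (fun h => hiTerm a (hc h) (hk h) (hr h))
    (fun h j => hasAlgCoeffs_hiTerm ha (hc h) (hk h) (hhr h) j)
  have h₂ : InSpanRel (∑ h, (Finsupp.single (⟨ZP a, hZ, hiTerm a (hc h) (hk h) (hr h),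
      hasAlgCoeffs_hiTerm ha (hc h) (hk h) (hhr h), γ⟩ : PeriodSymbol) (1 : ℂ) -
      (hiPrimVal a (hc h) (hk h) (hr h) (γ.toFun 1 0) - hiPrimVal a (hc h) (hk h) (hr h) (γ.toFun 0 0)) •
        Finsupp.single PeriodSymbol.unit (1 : ℂ))) :=
    span_finsetSum _ _ fun h _ => span_hiTerm ha (hc h) (hk h) (hhr h) γ
  obtain ⟨m, R, b, hR, hb, hsum⟩ := span_add h₁ h₂
  refine ⟨m, R, b, hR, hb, ?_⟩
  have e : (hiFormVal a hc hk hr (γ.toFun 1 0) - hiFormVal a hc hk hr (γ.toFun 0 0)) •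
      Finsupp.single PeriodSymbol.unit (1 : ℂ) =
      ∑ h, (hiPrimVal a (hc h) (hk h) (hr h) (γ.toFun 1 0) -
        hiPrimVal a (hc h) (hk h) (hr h) (γ.toFun 0 0)) • Finsupp.single PeriodSymbol.unit (1 : ℂ) := by
    rw [← Finset.sum_smul, hiFormVal, hiFormVal, Finset.sum_sub_distrib]
  rw [← hsum, e, Finset.sum_sub_distrib]
  have e' : (Finsupp.single (⟨ZP a, isSmoothAffineCurve_puncturedLine ha, hiForm a hc hk hr,
      hasAlgCoeffs_hiForm ha hc hk hhr, γ⟩ : PeriodSymbol) (1 : ℂ)) =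
      Finsupp.single (⟨ZP a, hZ, ∑ h, hiTerm a (hc h) (hk h) (hr h),
        hasAlgCoeffs_sum_apply _ _ (fun h j => hasAlgCoeffs_hiTerm ha (hc h) (hk h) (hhr h) j), γ⟩ :
        PeriodSymbol) (1 : ℂ) := rfl
  rw [e']
  abel

/-- **Reduction of a symbol with higher-order poles**: `(Z_a, ω₂, γ) ∼ (Z_a, ω, γ) + ΔH · 𝟙`
where `ω` is the simple-pole part ((R1) and `span_hiForm`). [folklore] -/
theorem span_inputForm₂ {a : Fin r → ℂ} (ha : ∀ i, IsAlgebraic ℚ (a i)) {rc : Fin r → ℂ}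
    (hrc : ∀ i, IsAlgebraic ℚ (rc i)) {d : ℕ} {pc : Fin d → ℂ} (hpc : ∀ k, IsAlgebraic ℚ (pc k))
    {n : ℕ} (hc : Fin n → Fin r) (hk : Fin n → ℕ) {hr : Fin n → ℂ}
    (hhr : ∀ h, IsAlgebraic ℚ (hr h)) (γ : CurvePath (ZP a)) :
    InSpanRel (Finsupp.single (⟨ZP a, isSmoothAffineCurve_puncturedLine ha, inputForm₂ a rc pc hc hk hr,
        hasAlgCoeffs_inputForm₂ ha hrc hpc hc hk hhr, γ⟩ : PeriodSymbol) (1 : ℂ) -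
      Finsupp.single (⟨ZP a, isSmoothAffineCurve_puncturedLine ha, inputForm a rc pc,
        hasAlgCoeffs_inputForm ha hrc hpc, γ⟩ : PeriodSymbol) (1 : ℂ) -
      (hiFormVal a hc hk hr (γ.toFun 1 0) - hiFormVal a hc hk hr (γ.toFun 0 0)) •
        Finsupp.single PeriodSymbol.unit (1 : ℂ)) := by
  have hZ := isSmoothAffineCurve_puncturedLine ha
  have r₁ := IsElementaryRelation.add (ZP a) hZ γ (inputForm₂ a rc pc hc hk hr) (inputForm a rc pc)
    (hiForm a hc hk hr) (hasAlgCoeffs_inputForm₂ ha hrc hpc hc hk hhr) (hasAlgCoeffs_inputForm ha hrc hpc)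
    (hasAlgCoeffs_hiForm ha hc hk hhr) rfl
  obtain ⟨m, R, b, hR, hb, hsum⟩ := span_add (span_of_rel r₁) (span_hiForm ha hc hk hhr γ)
  refine ⟨m, R, b, hR, hb, ?_⟩
  rw [← hsum]
  abel

/-- **Segment reduction with higher-order poles, generator-indexed**:
`(Z_a, ω₂, [z₀,z₁]) ∼ Σ_j (Σ_{q : idx q = j} r_q) ℓ(M_j) + (P(z₁) − P(z₀) + H(z₁) − H(z₀)) 𝟙`.
[cite: HuberWustholz2022, §13.1 (A)–(B) (p. 120), §3.3.1 (pp. 42–43)] -/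
theorem red_segment₂ {a : Fin r → ℂ} (ha : ∀ i, IsAlgebraic ℚ (a i)) {rc : Fin r → ℂ}
    (hrc : ∀ i, IsAlgebraic ℚ (rc i)) {d : ℕ} {pc : Fin d → ℂ} (hpc : ∀ k, IsAlgebraic ℚ (pc k))
    {n : ℕ} (hc : Fin n → Fin r) (hk : Fin n → ℕ) {hr : Fin n → ℂ}
    (hhr : ∀ h, IsAlgebraic ℚ (hr h))
    {z₀ z₁ : ℂ} (hz₀ : IsAlgebraic ℚ z₀) (γ : CurvePath (ZP a))
    (hγ : ∀ t ∈ Icc (0 : ℝ) 1, γ.toFun t = ![z₀ + t * (z₁ - z₀), (∏ i, (z₀ + t * (z₁ - z₀) - a i))⁻¹])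
    {m : ℕ} (M : Fin m → ℂ) (E : Fin m → CurvePath 𝔾m)
    (hE : ∀ j t, (E j).toFun t = ![exp ((1 - t) * 0 + t * M j), exp (-((1 - t) * 0 + t * M j))])
    (w : Fin r → ℂ) (idx : Fin r → Fin m) (hidx : ∀ q, M (idx q) = log (w q))
    (hw : ∀ i, w i * (z₀ - a i) = z₁ - a i) (hslit : ∀ i, 0 < (w i).re ∨ (w i).im ≠ 0) :
    InSpanRel (Finsupp.single (⟨ZP a, isSmoothAffineCurve_puncturedLine ha, inputForm₂ a rc pc hc hk hr,
        hasAlgCoeffs_inputForm₂ ha hrc hpc hc hk hhr, γ⟩ : PeriodSymbol) (1 : ℂ) -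
      ∑ j, (∑ q, if idx q = j then rc q else 0) • Finsupp.single (logSym (E j)) (1 : ℂ) -
      (polyPrimVal pc z₁ - polyPrimVal pc z₀ + (hiFormVal a hc hk hr z₁ - hiFormVal a hc hk hr z₀)) •
        Finsupp.single PeriodSymbol.unit (1 : ℂ)) := by
  have h₁ := span_inputForm₂ ha hrc hpc hc hk hhr γ
  have e₁ : γ.toFun 1 0 = z₁ := by
    rw [hγ 1 (by norm_num)]
    simp
  have e₀ : γ.toFun 0 0 = z₀ := by
    rw [hγ 0 (by norm_num)]
    simp
  rw [e₁, e₀] at h₁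
  have h₂ := red_segment ha hrc hpc hz₀ γ hγ M E hE w idx hidx hw hslit
  obtain ⟨m', R, b, hR, hb, hsum⟩ := span_add h₁ h₂
  refine ⟨m', R, b, hR, hb, ?_⟩
  rw [← hsum, add_smul]
  abel

/-- **Loop reduction with higher-order poles, generator-indexed**:
`(Z_a, ω₂, circle around a_c) ∼ r_c ℓ(2πi) + 0 · 𝟙`. [cite: HuberWustholz2022, §13.1 (A)–(B) (p. 120)] -/
theorem red_loop₂ {a : Fin r → ℂ} (ha : ∀ i, IsAlgebraic ℚ (a i)) {rc : Fin r → ℂ}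
    (hrc : ∀ i, IsAlgebraic ℚ (rc i)) {d : ℕ} {pc : Fin d → ℂ} (hpc : ∀ k, IsAlgebraic ℚ (pc k))
    {n : ℕ} (hc : Fin n → Fin r) (hk : Fin n → ℕ) {hr : Fin n → ℂ}
    (hhr : ∀ h, IsAlgebraic ℚ (hr h))
    (c : Fin r) {ρ : ℝ} (hρ : 0 < ρ) (hρalg : IsAlgebraic ℚ (ρ : ℂ))
    (hsmall : ∀ j, j ≠ c → ρ ^ 2 < Complex.normSq (a c - a j)) (γ : CurvePath (ZP a))
    (hγ : ∀ t ∈ Icc (0 : ℝ) 1, γ.toFun t =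
      ![a c + ρ * exp (2 * π * I * t), (∏ i, (a c + ρ * exp (2 * π * I * t) - a i))⁻¹])
    {m : ℕ} (M : Fin m → ℂ) (E : Fin m → CurvePath 𝔾m)
    (hE : ∀ j t, (E j).toFun t = ![exp ((1 - t) * 0 + t * M j), exp (-((1 - t) * 0 + t * M j))])
    (j₀ : Fin m) (hj₀ : M j₀ = 2 * π * I) :
    InSpanRel (Finsupp.single (⟨ZP a, isSmoothAffineCurve_puncturedLine ha, inputForm₂ a rc pc hc hk hr,
        hasAlgCoeffs_inputForm₂ ha hrc hpc hc hk hhr, γ⟩ : PeriodSymbol) (1 : ℂ) -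
      ∑ j, (if j₀ = j then rc c else 0) • Finsupp.single (logSym (E j)) (1 : ℂ) -
      (0 : ℂ) • Finsupp.single PeriodSymbol.unit (1 : ℂ)) := by
  have h₁ := span_inputForm₂ ha hrc hpc hc hk hhr γ
  have e₁ : γ.toFun 1 0 = γ.toFun 0 0 := by
    rw [hγ 1 (by norm_num), hγ 0 (by norm_num)]
    simp [Complex.exp_two_pi_mul_I]
  rw [e₁, sub_self, zero_smul, sub_zero] at h₁
  have h₂ := red_loop ha hrc hpc c hρ hρalg hsmall γ hγ M E hE j₀ hj₀
  obtain ⟨m', R, b, hR, hb, hsum⟩ := span_add h₁ h₂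
  refine ⟨m', R, b, hR, hb, ?_⟩
  rw [← hsum]
  abel

end HigherPoles

end Summit.KontsevichZagierPeriods.KzOnePeriods.G0Derivation

end
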